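import Mathlib
import Literature.NumberTheory.Transcendental.LinEDS
import Literature.NumberTheory.Transcendental.LinEDSCode
import Literature.NumberTheory.Transcendental.MZVShuffleRegularisation
import Summits.KontsevichZagierPeriods.KontsevichZagierPeriods.Theorems.FurushoPentagonKernelModuloPeriodConjectureRowBitsParityAux
import HarnessLib

/-!
# `KernelModuloPeriodConjecture`, line `Sketch`: row parity (E9), part B — support shapes

Crux `FurushoPentagon.KernelModuloPeriodConjecture` (stmt-KontsevichZagierPeriods-15058), line
`Sketch`, registered stub `stub_rowBits_parity` of the lead's skeleton v11 (soundness of the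
kernel-checkable GF(2) rank engine `Literature/NumberTheory/Transcendental/LinEDS.lean`): for a
valid row name, bit `c` (a column) of the kernel's row `LinEDS.rowBits k ν` is the parity of the
integer matrix entry `LinEDS.entry k ν c` (the folded integer row at the word of `c`); the row has
bits only at columns; the folded integer row is supported on admissible words of weight `k`.
Part B assembles part A (`stub_rowZ_parity_raw`: parity of the raw row), E3 (`stub_foldDiv_testBit`:
bits of the fold), E4 (`stub_insY_count`: insertions = shuffle with `y`) and E8 (`stub_cols_spec`):
the words in the support of the integer row of a VALID name begin with `x` or with `y x` (this is
what the exclusion of `t = (1,1,…)` buys) and end with `y`; the fold acts on them as on the bits.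

References: K. Ihara, M. Kaneko, D. Zagier, Compos. Math. 142 (2006) §2 [IharaKanekoZagier2006].
-/

namespace Summit.KontsevichZagierPeriods.FurushoPentagon.KernelModuloPeriodConjecture

open Literature.NumberTheory.Transcendental
open Literature.NumberTheory.Transcendental.LinEDS

/-! ### Unpacking a valid name -/

/-- The data of a valid name: `s = a :: s'` with `2 ≤ a`, positive entries, `t = b :: t'` with
positive entries, not both `b = 1` and `t'` beginning with `1`, total weight `k`. [folklore] -/
theorem rowE9_validName {k : ℕ} {ν : List ℕ × List ℕ} (h : LinEDS.validName k ν = true) :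
    ∃ a s' b t', ν.1 = a :: s' ∧ ν.2 = b :: t' ∧ 2 ≤ a ∧ (∀ i ∈ s', 1 ≤ i) ∧ 1 ≤ b ∧
      (∀ i ∈ t', 1 ≤ i) ∧ ¬ (b = 1 ∧ t'.head? = some 1) ∧ ν.1.sum + ν.2.sum = k := by
  obtain ⟨s, t⟩ := ν
  match s, t, h with
  | [], _, h => exact absurd h (by simp [LinEDS.validName])
  | _ :: _, [], h => exact absurd h (by simp [LinEDS.validName])
  | a :: s', b :: t', h =>
    simp only [LinEDS.validName, Bool.and_eq_true, decide_eq_true_eq, List.all_eq_true,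
      Bool.not_eq_true', Bool.and_eq_false_imp, beq_iff_eq, beq_eq_false_iff_ne, ne_eq] at h
    obtain ⟨⟨⟨⟨⟨ha, hs⟩, hb⟩, ht⟩, hno⟩, hk⟩ := h
    refine ⟨a, s', b, t', rfl, rfl, ha, hs, hb, ht, fun ⟨hb1, h1⟩ => ?_, hk⟩
    exact hno hb1 h1

/-! ### First letters of the words in the support of the integer row -/

/-- The binary word of an index beginning with an entry `≥ 2` begins with `x`; of one beginning
`1, c` with `c ≥ 2` is `y x …`. [folklore] -/
theorem rowE9_binaryWord_shape {c : ℕ} (hc : 2 ≤ c) (u : List ℕ) :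
    (MZV.binaryWord (c :: u)).head? = some false ∧
      ∃ r, MZV.binaryWord (1 :: c :: u) = true :: false :: r := by
  obtain ⟨d, rfl⟩ : ∃ d, c = d + 2 := ⟨c - 2, by omega⟩
  refine ⟨?_, ⟨List.replicate d false ++ [true] ++ MZV.binaryWord u, ?_⟩⟩
  · simp [MZV.binaryWord, show d + 2 - 1 = d + 1 from rfl, List.replicate_succ]
  · simp [MZV.binaryWord, show d + 2 - 1 = d + 1 from rfl, List.replicate_succ]

/-- Terms of a harmonic product `(a s') ∗ t` with `2 ≤ a`, `t` positive and not beginning `1, 1`: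
each begins with an entry `≥ 2`, or with `1` followed by an entry `≥ 2`. [cite: Hoffman1997, §2] -/
theorem rowE9_stuffle_shape {a : ℕ} (ha : 2 ≤ a) (s' : List ℕ) :
    ∀ (t : List ℕ), (∀ i ∈ t, 1 ≤ i) → ¬ (t.head? = some 1 ∧ t.tail.head? = some 1) →
      ∀ u ∈ MZV.stuffle (a :: s') t,
        (∃ c u', u = c :: u' ∧ 2 ≤ c) ∨ (∃ c u', u = 1 :: c :: u' ∧ 2 ≤ c)
  | [], _, _, u, hu => by
    rw [MZV.stuffle_nil_right, List.mem_singleton] at hu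
    exact Or.inl ⟨a, s', hu, ha⟩
  | b :: t', ht, hno, u, hu => by
    rw [MZV.stuffle_cons_cons, List.mem_append, List.mem_append, List.mem_map, List.mem_map,
      List.mem_map] at hu
    have hb : 1 ≤ b := ht b (by simp)
    rcases hu with ⟨u', _, rfl⟩ | ⟨u', hu', rfl⟩ | ⟨u', _, rfl⟩
    · exact Or.inl ⟨a, u', rfl, ha⟩
    · by_cases hb1 : b = 1
      · subst hb1
        -- `u' ∈ (a s') ∗ t'`: its first entry is `a`, `t'.head` (≠ 1) or a sum `≥ 3`
        cases t' with
        | nil =>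
          rw [MZV.stuffle_nil_right, List.mem_singleton] at hu'
          exact Or.inr ⟨a, s', by rw [hu'], ha⟩
        | cons b' t'' =>
          have hb' : 2 ≤ b' := by
            have h1 : 1 ≤ b' := ht b' (by simp)
            have : ¬ b' = 1 := fun h => hno ⟨rfl, by simp [h]⟩
            omega
          rw [MZV.stuffle_cons_cons, List.mem_append, List.mem_append, List.mem_map,
            List.mem_map, List.mem_map] at hu'
          rcases hu' with ⟨u'', _, rfl⟩ | ⟨u'', _, rfl⟩ | ⟨u'', _, rfl⟩
          · exact Or.inr ⟨a, u'', rfl, ha⟩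
          · exact Or.inr ⟨b', u'', rfl, hb'⟩
          · exact Or.inr ⟨a + b', u'', rfl, by omega⟩
      · exact Or.inl ⟨b, u', rfl, by omega⟩
    · exact Or.inl ⟨a + b, u', rfl, by omega⟩

/-- Interleavings of a word beginning with `x` and a word beginning with `x`, with `y x`, or equal
to `y`, begin with `x` or with `y x`. [folklore] -/
theorem rowE9_shuffle_shape (α : List Bool) :
    ∀ (β : List Bool), (β.head? = some false ∨ (∃ β', β = true :: false :: β') ∨ β = [true]) →
      ∀ w ∈ MZV.shuffleWord (false :: α) β, w.head? = some false ∨ ∃ r, w = true :: false :: r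
  | [], h, _, _ => by simp at h
  | b :: β', h, w, hw => by
    rw [MZV.shuffleWord_cons_cons, List.mem_append, List.mem_map, List.mem_map] at hw
    rcases hw with ⟨w', _, rfl⟩ | ⟨w', hw', rfl⟩
    · exact Or.inl rfl
    · rcases h with h | ⟨β'', h⟩ | h
      · simp at h; subst h; exact Or.inl rfl
      · simp only [List.cons.injEq] at h
        obtain ⟨rfl, rfl⟩ := h
        rw [MZV.shuffleWord_cons_cons, List.mem_append, List.mem_map, List.mem_map] at hw'
        rcases hw' with ⟨w'', _, rfl⟩ | ⟨w'', _, rfl⟩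
        · exact Or.inr ⟨w'', rfl⟩
        · exact Or.inr ⟨w'', rfl⟩
      · simp only [List.cons.injEq] at h
        obtain ⟨rfl, rfl⟩ := h
        rw [MZV.shuffleWord_nil_right, List.mem_singleton] at hw'
        exact Or.inr ⟨α, by rw [hw']⟩

/-- Interleavings of two nonempty words ending in `y` end in `y`. [folklore] -/
theorem rowE9_shuffle_getLast : ∀ (u v : List Bool), u ≠ [] → v ≠ [] →
    u.getLast? = some true → v.getLast? = some true →
      ∀ w ∈ MZV.shuffleWord u v, w.getLast? = some true
  | [], _, hu, _, _, _, _, _ => absurd rfl hu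
  | _ :: _, [], _, hv, _, _, _, _ => absurd rfl hv
  | a :: u, b :: v, _, _, hu, hv, w, hw => by
    rw [MZV.shuffleWord_cons_cons, List.mem_append, List.mem_map, List.mem_map] at hw
    rcases hw with ⟨w', hw', rfl⟩ | ⟨w', hw', rfl⟩
    · cases u with
      | nil =>
        rw [MZV.shuffleWord_nil_left, List.mem_singleton] at hw'
        subst hw'
        simpa using hv
      | cons a' u' =>
        have h := rowE9_shuffle_getLast (a' :: u') (b :: v) (List.cons_ne_nil _ _)
          (List.cons_ne_nil _ _) (by simpa using hu) hv w' hw'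
        have hne : w' ≠ [] := by rintro rfl; simp at h
        rw [List.getLast?_cons, h]; cases w' <;> simp_all
    · cases v with
      | nil =>
        rw [MZV.shuffleWord_nil_right, List.mem_singleton] at hw'
        subst hw'
        simpa using hu
      | cons b' v' =>
        have h := rowE9_shuffle_getLast (a :: u) (b' :: v') (List.cons_ne_nil _ _)
          (List.cons_ne_nil _ _) hu (by simpa using hv) w' hw'
        rw [List.getLast?_cons, h]; cases w' <;> simp_all

/-- **Support shapes.** For a valid name, every word in the support of the integer row has length
`k`, begins with `x` or with `y x`, and ends with `y`. [cite: IharaKanekoZagier2006, §2] -/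
theorem rowE9_support_shape {k : ℕ} {ν : List ℕ × List ℕ} (h : LinEDS.validName k ν = true)
    {w : List Bool} (hw : w ∈ (LinEDS.rowZ ν).support) :
    w.length = k ∧ (w.head? = some false ∨ ∃ r, w = true :: false :: r) ∧
      w.getLast? = some true := by
  obtain ⟨a, s', b, t', h1, h2, ha, hs', hb, ht', hno, hk⟩ := rowE9_validName h
  have hs : ∀ i ∈ ν.1, 1 ≤ i := by rw [h1]; exact List.forall_mem_cons.mpr ⟨by omega, hs'⟩
  have ht : ∀ i ∈ ν.2, 1 ≤ i := by rw [h2]; exact List.forall_mem_cons.mpr ⟨hb, ht'⟩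
  refine ⟨hk ▸ rowE9_length_of_mem_support hs ht hw, ?_, ?_⟩
  · rcases rowE9_mem_support_rowZ hw with ⟨u, hu, rfl⟩ | hw'
    · rw [h1, h2] at hu
      rcases rowE9_stuffle_shape ha s' (b :: t') (h2 ▸ ht)
          (by rintro ⟨hb1, hh⟩; exact hno ⟨by simpa using hb1, by simpa using hh⟩) u hu with
        ⟨c, u', rfl, hc⟩ | ⟨c, u', rfl, hc⟩
      · exact Or.inl (rowE9_binaryWord_shape hc u').1
      · exact Or.inr (rowE9_binaryWord_shape hc u').2
    · rw [h1, h2] at hw'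
      obtain ⟨d, rfl⟩ : ∃ d, a = d + 2 := ⟨a - 2, by omega⟩
      have hα : MZV.binaryWord ((d + 2) :: s') =
          false :: (List.replicate d false ++ [true] ++ MZV.binaryWord s') := by
        simp [MZV.binaryWord, show d + 2 - 1 = d + 1 from rfl, List.replicate_succ]
      rw [hα] at hw'
      refine rowE9_shuffle_shape _ _ ?_ w hw'
      rcases Nat.lt_or_ge b 2 with hb2 | hb2
      · have hb1 : b = 1 := by omega
        subst hb1
        cases t' with
        | nil => exact Or.inr (Or.inr rfl)
        | cons b' t'' =>
          have hb' : 2 ≤ b' := by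
            have := ht' b' (by simp)
            have hne : ¬ b' = 1 := fun h => hno ⟨rfl, by simp [h]⟩
            omega
          refine Or.inr (Or.inl ?_)
          obtain ⟨r, hr⟩ := (rowE9_binaryWord_shape hb' t'').2
          exact ⟨r, hr⟩
      · exact Or.inl (rowE9_binaryWord_shape hb2 t').1
  · rcases rowE9_mem_support_rowZ hw with ⟨u, hu, rfl⟩ | hw'
    · refine MZV.getLast?_binaryWord ?_
      rintro rfl
      have := MZV.sum_of_mem_stuffle _ _ hu
      rw [h1] at this; simp at this; omega
    · refine rowE9_shuffle_getLast _ _ ?_ ?_ (MZV.getLast?_binaryWord (by rw [h1]; simp))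
        (MZV.getLast?_binaryWord (by rw [h2]; simp)) w hw'
      · rw [h1]; simp [MZV.binaryWord]
      · rw [h2]; simp [MZV.binaryWord]

/-! ### Bits of the raw row live on words of the support -/

/-- Bits of the raw row beyond `2^k` vanish (all words have length `k`). [folklore] -/
theorem rowE9_rawBits_testBit_lt {k : ℕ} {ν : List ℕ × List ℕ} (h : LinEDS.validName k ν = true)
    {i : ℕ} (hi : (LinEDS.rawBits ν).testBit i = true) : i < 2 ^ k := by
  obtain ⟨a, s', b, t', h1, h2, ha, hs', hb, ht', -, hk⟩ := rowE9_validName h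
  have hs : ∀ i ∈ ν.1, 1 ≤ i := by rw [h1]; exact List.forall_mem_cons.mpr ⟨by omega, hs'⟩
  have ht : ∀ i ∈ ν.2, 1 ≤ i := by rw [h2]; exact List.forall_mem_cons.mpr ⟨hb, ht'⟩
  by_contra hi'
  push Not at hi'
  have e1 : (LinEDS.stBits ν.1 ν.2).testBit i = false := by
    rw [stBitsE2_testBit_eq, decide_eq_false_iff_not, List.countP_eq_zero.mpr, Nat.odd_iff]
    · simp
    · intro u hu
      simp only [decide_eq_true_eq]
      have := icode_lt (MZV.one_le_of_mem_stuffle _ _ hs ht u hu)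
      rw [MZV.sum_of_mem_stuffle _ _ hu, hk] at this
      omega
  have e2 : (LinEDS.shBits (MZV.binaryWord ν.1) (MZV.binaryWord ν.2)).testBit i = false := by
    rw [shBitsE1_testBit_eq_bodd, List.countP_eq_zero.mpr]
    · rfl
    · intro w hw
      simp only [decide_eq_true_eq]
      have := code_lt w
      rw [MZV.length_of_mem_shuffleWord _ _ hw, MZV.length_binaryWord hs, MZV.length_binaryWord ht,
        MZV.weight, MZV.weight, hk] at this
      omega
  rw [LinEDS.rawBits, Nat.testBit_xor, e1, e2] at hi
  exact Bool.false_ne_true hi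

/-- A set bit `i` of the raw row of a valid name is the code of a word of the support: hence
`i < 2^(k-1)` (word `x…`) or `2^(k-1) ≤ i < 2^(k-1) + 2^(k-2)` (word `y x …`). [folklore] -/
theorem rowE9_rawBits_support {k : ℕ} {ν : List ℕ × List ℕ} (h : LinEDS.validName k ν = true)
    (i : ℕ) (hi : (LinEDS.rawBits ν).testBit i = true) :
    i < 2 ^ (k - 1) ∨ (2 ^ (k - 1) ≤ i ∧ i < 2 ^ (k - 1) + 2 ^ (k - 2)) := by
  obtain ⟨a, s', b, t', h1, h2, ha, hs', hb, ht', -, hk⟩ := rowE9_validName h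
  have hs : ∀ i ∈ ν.1, 1 ≤ i := by rw [h1]; exact List.forall_mem_cons.mpr ⟨by omega, hs'⟩
  have ht : ∀ i ∈ ν.2, 1 ≤ i := by rw [h2]; exact List.forall_mem_cons.mpr ⟨hb, ht'⟩
  have hk3 : 3 ≤ k := by rw [← hk, h1, h2]; simp; omega
  obtain ⟨m, rfl⟩ : ∃ m, k = m + 2 := ⟨k - 2, by omega⟩
  simp only [Nat.add_sub_cancel, show m + 2 - 1 = m + 1 from rfl]
  have hik := rowE9_rawBits_testBit_lt h hi
  have hwl : (LinEDS.wordOfCode (m + 2) i).length = ν.1.sum + ν.2.sum := by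
    rw [length_wordOfCode, hk]
  have hcw : LinEDS.code (LinEDS.wordOfCode (m + 2) i) = i := code_wordOfCode hik
  have hodd : Odd (LinEDS.rowZ ν (LinEDS.wordOfCode (m + 2) i)) :=
    (rowE9_odd_rowZ_iff hs ht hwl).mpr (by rw [hcw]; exact hi)
  have hsupp : LinEDS.wordOfCode (m + 2) i ∈ (LinEDS.rowZ ν).support := by
    rw [Finsupp.mem_support_iff]; intro h0; rw [h0] at hodd; exact (by decide : ¬ Odd (0 : ℤ)) hodd
  obtain ⟨-, hshape, -⟩ := rowE9_support_shape h hsupp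
  rw [← hcw]
  rcases hshape with hx | ⟨r, hr⟩
  · left
    rw [List.eq_cons_of_mem_head? hx, code_cons]
    simp only [Bool.toNat_false, zero_mul, zero_add]
    have hl : (LinEDS.wordOfCode (m + 2) i).tail.length = m + 1 := by
      rw [List.length_tail, length_wordOfCode]; rfl
    have := code_lt (LinEDS.wordOfCode (m + 2) i).tail
    rwa [hl] at this
  · right
    have hrl : r.length = m := by
      have := congrArg List.length hr
      rw [length_wordOfCode] at this; simp at this; omega
    rw [hr, code_cons, code_cons]
    simp only [Bool.toNat_true, one_mul, Bool.toNat_false, zero_mul, zero_add, List.length_cons,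
      hrl]
    have := code_lt r; rw [hrl] at this
    constructor <;> omega

/-- **Registered helper stub `stub_rowZ_support_shape`** (lead c5, E9 part B; crux
stmt-KontsevichZagierPeriods-15058, line `Sketch`): for a valid name, every word in the support of
the integer double-shuffle row has length `k`, begins with `x` or with `y x`, and ends with `y`.
[cite: IharaKanekoZagier2006, §2] -/
theorem stub_rowZ_support_shape :
    ∀ (k : ℕ) (ν : List ℕ × List ℕ), LinEDS.validName k ν = true →
      ∀ w ∈ (LinEDS.rowZ ν).support,
        w.length = k ∧ (w.head? = some false ∨ ∃ r, w = true :: false :: r) ∧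
          w.getLast? = some true :=
  fun _ _ h _ hw => rowE9_support_shape h hw

end Summit.KontsevichZagierPeriods.FurushoPentagon.KernelModuloPeriodConjecture
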